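import Literature.NumberTheory.LFunctions.UniformClassGroupPNTGeneralDegree
import Literature.NumberTheory.LFunctions.UniformClassGroupPNTInputs
import Literature.NumberTheory.LFunctions.DedekindZetaProofs
import Mathlib.NumberTheory.NumberField.ClassNumber
import HarnessLib

/-!
# Elementary inputs for Thorner–Zaman's Theorem 1.4 over the Hilbert class field of a number
# field of ANY degree: a uniform class number bound `h_K ≤ (4e)^{n_K} |d_K| ≤ Q⁴` and the error term

Topic `Literature/NumberTheory/LFunctions` (namespace `Literature.NumberTheory.LFunctions.NumberField`),
sibling of `UniformClassGroupPNTGeneralDegree.lean` (named fact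
`ThornerZaman2019_classPNT_hilbertClassField`, [ThornerZaman2019, Thm. 1.4] for `L = H_K`, `K` of
any degree `n_K > 1`, `Q = |d_K| n_K^{n_K}`).  Everything here is PROVED (theorems only; no
definition, no named fact).  These are the field-uniform elementary inputs of the last step of
the printed proof ([ThornerZaman2019, §5, proof of Thm. 5.1]: absorb `𝓔₀(x) ≪ n_K x^{1/2}` and
`log D_L` into the error term, using Lemma 2.4 `log D_L ≪ Q²`), for general degree:

* `card_nonZeroDivisors_absNorm_le_le` — **uniform ideal count**: for every number field `K`
  and `N ≥ 0`, `#{𝔞 ≠ 0 : N𝔞 ≤ N} ≤ N² ζ_K(2) ≤ N² e^{n_K}` (the tree's uniform bound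
  `|ζ_K(s)| ≤ e^{n_K/(σ−1)}`, `norm_dedekindZeta_le_exp_finrank_div`, Lagarias–Odlyzko §5);
* `classNumber_le_exp_mul_absdiscr` — **`h_K ≤ (4e)^{n_K} |d_K|`** for every number field:
  Minkowski (Mathlib `NumberField.exists_ideal_in_class_of_norm_le`: every class contains
  `𝔞` with `N𝔞 ≤ (4/π)^{r₂} n!/nⁿ √|d_K| ≤ 2^{n_K} √|d_K|`) and the ideal count.  This is the case
  `L = H_K`, `𝒬 = 1` of the bound `[L:K] ≤ D_K 𝒬 e^{O(n_K)}` quoted from [Weiss] in the proof of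
  [ThornerZaman2019, Lemma 2.4] (`log D_L = h_K log D_K ≪ Q²` for the Hilbert class field);
* `classNumber_le_condQn_pow` — hence **`h_K ≤ Q⁴`**, `Q = condQn K = |d_K| n_K^{n_K}`
  (`(4e)^{n} ≤ n^{4n}` for `n ≥ 2`), and `finrank_le_condQn` (`n_K ≤ Q`),
  `ThornerZaman.twelve_le_condQn` (`Q ≥ 12` for `n_K > 1`, Minkowski `|d_K| ≥ 3`);
* the error term `errorTermN c Q n x = e^{−c log x/log Q} + e^{−√(c log x)/√n}` is non-increasing
  in `x ≥ 1`, `errorTermN c Q n (√x) = errorTermN (c/2) Q n x`, and dominates `e^{−c log x/log Q}`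
  (`ThornerZaman.errorTermN_antitoneOn`, `errorTermN_sqrt`, `exp_le_errorTermN`).

## References

* J. Thorner, A. Zaman, *A unified and improved Chebotarev density theorem*, Algebra Number
  Theory 13 (2019) 1039–1068, Lemma 2.4 and §5 (proof of Thm. 5.1). [ThornerZaman2019]
* A. Weiss, *The least prime ideal*, J. reine angew. Math. 338 (1983) 56–94, §1 (the bound
  `h ≤ D 𝒬 e^{O(n)}` quoted by Thorner–Zaman). [Weiss1983]
* J. C. Lagarias, A. M. Odlyzko, *Effective versions of the Chebotarev density theorem* (1977),
  §5 (`ζ_K(σ) ≤ ζ(σ)^{n_K}`). [LagariasOdlyzko1977]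
-/

noncomputable section

open scoped NumberField nonZeroDivisors
open Finset Real NumberField NumberField.InfinitePlace Module

namespace Literature.NumberTheory.LFunctions.NumberField

variable {K : Type*} [Field K] [NumberField K]

/-! ### A uniform count of the ideals of bounded norm -/

/-- `N(𝔞)^{-2}` (complex power) is the real number `(N𝔞)⁻²` (and `0` for the zero ideal).
[folklore] -/
theorem absNorm_cpow_neg_two (I : Ideal (𝓞 K)) :
    ((Ideal.absNorm I : ℕ) : ℂ) ^ (-(2 : ℂ)) = ((((Ideal.absNorm I : ℕ) : ℝ) ^ 2)⁻¹ : ℝ) := by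
  rw [Complex.cpow_neg, Complex.cpow_ofNat]
  push_cast
  rfl

variable (K) in
/-- **Uniform ideal count**: `#{𝔞 ≠ 0 : N𝔞 ≤ N} ≤ N² · e^{n_K}` for every number field `K`
(`1 ≤ N²/N𝔞²` termwise, `∑_𝔞 N𝔞^{−2} = ζ_K(2) ≤ e^{n_K}` by the tree's
`norm_dedekindZeta_le_exp_finrank_div`, i.e. `ζ_K(σ) ≤ ζ(σ)^{n_K} ≤ e^{n_K/(σ−1)}`).
[cite: LagariasOdlyzko1977, §5] -/
theorem card_nonZeroDivisors_absNorm_le_le (N : ℕ) :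
    (Nat.card {I : (Ideal (𝓞 K))⁰ // Ideal.absNorm (I : Ideal (𝓞 K)) ≤ N} : ℝ) ≤
      (N : ℝ) ^ 2 * Real.exp (finrank ℚ K) := by
  classical
  -- the finite set of nonzero ideals of norm `≤ N`
  set S : Set (Ideal (𝓞 K)) := {I | I ≠ ⊥ ∧ Ideal.absNorm I ≤ N} with hS
  have hSfin : S.Finite := (Ideal.finite_setOf_absNorm_le N).subset fun I hI ↦ hI.2
  haveI : Finite S := hSfin.to_subtype
  have hcard : Nat.card {I : (Ideal (𝓞 K))⁰ // Ideal.absNorm (I : Ideal (𝓞 K)) ≤ N} ≤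
      hSfin.toFinset.card := by
    rw [← Nat.card_eq_card_finite_toFinset hSfin]
    refine Nat.card_le_card_of_injective
      (fun I ↦ ⟨(I.1 : Ideal (𝓞 K)), nonZeroDivisors.ne_zero I.1.2, I.2⟩) ?_
    intro I J h
    simp only [Subtype.mk.injEq] at h
    exact Subtype.ext (Subtype.ext h)
  -- the Dirichlet series at `s = 2`
  have h2 : (1 : ℝ) < (2 : ℂ).re := by norm_num
  have hsum := Literature.NumberTheory.LFunctions.hasSum_absNorm_cpow K h2
  have hre := Complex.hasSum_re hsum
  simp only [absNorm_cpow_neg_two, Complex.ofReal_re] at hre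
  have hle : ∑ I ∈ hSfin.toFinset, (((Ideal.absNorm I : ℕ) : ℝ) ^ 2)⁻¹ ≤
      (NumberField.dedekindZeta K 2).re :=
    sum_le_hasSum _ (fun I _ ↦ by positivity) hre
  have hzeta : (NumberField.dedekindZeta K 2).re ≤ Real.exp (finrank ℚ K) := by
    refine (Complex.re_le_norm _).trans ((norm_dedekindZeta_le_exp_finrank_div K h2).trans ?_)
    norm_num
  -- termwise `1 ≤ N² (N𝔞)⁻²` on `S`
  have hterm : ∀ I ∈ hSfin.toFinset, (1 : ℝ) ≤ (N : ℝ) ^ 2 * (((Ideal.absNorm I : ℕ) : ℝ) ^ 2)⁻¹ := by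
    intro I hI
    rw [Set.Finite.mem_toFinset] at hI
    obtain ⟨hI0, hIN⟩ := hI
    have h1 : (1 : ℝ) ≤ ((Ideal.absNorm I : ℕ) : ℝ) := by
      have : Ideal.absNorm I ≠ 0 := by rwa [Ne, Ideal.absNorm_eq_zero_iff]
      exact_mod_cast Nat.one_le_iff_ne_zero.mpr this
    have hN : ((Ideal.absNorm I : ℕ) : ℝ) ≤ N := by exact_mod_cast hIN
    rw [← div_eq_mul_inv, le_div_iff₀ (by positivity), one_mul]
    exact pow_le_pow_left₀ (by positivity) hN 2
  calc (Nat.card {I : (Ideal (𝓞 K))⁰ // Ideal.absNorm (I : Ideal (𝓞 K)) ≤ N} : ℝ)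
      ≤ hSfin.toFinset.card := by exact_mod_cast hcard
    _ = ∑ I ∈ hSfin.toFinset, (1 : ℝ) := by simp
    _ ≤ ∑ I ∈ hSfin.toFinset, (N : ℝ) ^ 2 * (((Ideal.absNorm I : ℕ) : ℝ) ^ 2)⁻¹ := sum_le_sum hterm
    _ = (N : ℝ) ^ 2 * ∑ I ∈ hSfin.toFinset, (((Ideal.absNorm I : ℕ) : ℝ) ^ 2)⁻¹ := by
        rw [mul_sum]
    _ ≤ (N : ℝ) ^ 2 * Real.exp (finrank ℚ K) :=
        mul_le_mul_of_nonneg_left (hle.trans hzeta) (by positivity)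

/-! ### Minkowski: every class contains an ideal of norm `≤ 2^{n_K} √|d_K|` -/

/-- Minkowski's constant is at most `2^{n_K}`: `(4/π)^{r₂} · n!/nⁿ ≤ 2^{r₂} ≤ 2^{n_K}`.
[folklore] -/
theorem minkowskiConst_le :
    (4 / π) ^ nrComplexPlaces K * ((Nat.factorial (finrank ℚ K) : ℝ) / (finrank ℚ K : ℝ) ^ finrank ℚ K) ≤
      (2 : ℝ) ^ finrank ℚ K := by
  have hπ : (4 : ℝ) / π ≤ 2 := by
    rw [div_le_iff₀ Real.pi_pos]
    linarith [Real.two_le_pi]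
  have hπ0 : (0 : ℝ) ≤ 4 / π := by positivity
  have hr : nrComplexPlaces K ≤ finrank ℚ K := by
    have := card_add_two_mul_card_eq_rank K
    omega
  have hfac : ((Nat.factorial (finrank ℚ K) : ℝ) / (finrank ℚ K : ℝ) ^ finrank ℚ K) ≤ 1 := by
    refine div_le_one_of_le₀ ?_ (by positivity)
    exact_mod_cast Nat.factorial_le_pow (finrank ℚ K)
  calc (4 / π) ^ nrComplexPlaces K *
        ((Nat.factorial (finrank ℚ K) : ℝ) / (finrank ℚ K : ℝ) ^ finrank ℚ K)
      ≤ (2 : ℝ) ^ nrComplexPlaces K * 1 :=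
        mul_le_mul (pow_le_pow_left₀ hπ0 hπ _) hfac (by positivity) (by positivity)
    _ ≤ (2 : ℝ) ^ finrank ℚ K := by
        rw [mul_one]
        exact pow_le_pow_right₀ (by norm_num) hr

/-- **Minkowski** (Mathlib `NumberField.exists_ideal_in_class_of_norm_le`, weakened): every
ideal class of `K` contains a nonzero integral ideal of norm at most `2^{n_K} √|d_K|`. [folklore] -/
theorem exists_mk0_eq_absNorm_le (C : ClassGroup (𝓞 K)) :
    ∃ I : (Ideal (𝓞 K))⁰, ClassGroup.mk0 I = C ∧
      (Ideal.absNorm (I : Ideal (𝓞 K)) : ℝ) ≤ (2 : ℝ) ^ finrank ℚ K * Real.sqrt |(discr K : ℝ)| := by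
  obtain ⟨I, hI, hle⟩ := NumberField.exists_ideal_in_class_of_norm_le C
  refine ⟨I, hI, hle.trans ?_⟩
  rw [← mul_assoc]
  exact mul_le_mul_of_nonneg_right minkowskiConst_le (Real.sqrt_nonneg _)

/-! ### The class number bound -/

variable (K) in
/-- **`h_K ≤ (4e)^{n_K} |d_K|`** for every number field `K`: the classes are represented by
the nonzero ideals of norm `≤ 2^{n_K} √|d_K|` (Minkowski), of which there are at most
`(2^{n_K} √|d_K|)² e^{n_K}` (`card_nonZeroDivisors_absNorm_le_le`).  The case `L = H_K` (`𝒬 = 1`)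
of the bound `[L:K] ≤ D_K 𝒬 e^{O(n_K)}` used in the proof of [ThornerZaman2019, Lemma 2.4]
(there quoted from [Weiss1983]). [cite: ThornerZaman2019, Lemma 2.4 (proof)] -/
theorem classNumber_le_exp_mul_absdiscr :
    (classNumber K : ℝ) ≤ (4 * Real.exp 1) ^ finrank ℚ K * |(discr K : ℝ)| := by
  classical
  set B : ℝ := (2 : ℝ) ^ finrank ℚ K * Real.sqrt |(discr K : ℝ)| with hB
  have hB0 : 0 ≤ B := by positivity
  set N : ℕ := ⌊B⌋₊ with hN
  -- `h_K ≤ #{𝔞 ≠ 0 : N𝔞 ≤ N}`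
  haveI : Finite {I : (Ideal (𝓞 K))⁰ // Ideal.absNorm (I : Ideal (𝓞 K)) ≤ N} :=
    (Ideal.finite_setOf_absNorm_le₀ N).to_subtype
  have h1 : classNumber K ≤ Nat.card {I : (Ideal (𝓞 K))⁰ // Ideal.absNorm (I : Ideal (𝓞 K)) ≤ N} := by
    rw [classNumber, ← Nat.card_eq_fintype_card]
    refine Nat.card_le_card_of_surjective (fun I ↦ ClassGroup.mk0 I.1) fun C ↦ ?_
    obtain ⟨I, hI, hle⟩ := exists_mk0_eq_absNorm_le C
    exact ⟨⟨I, Nat.le_floor hle⟩, hI⟩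
  -- `#{𝔞 ≠ 0 : N𝔞 ≤ N} ≤ N² e^{n} ≤ B² e^{n} = 4^{n} |d_K| e^{n}`
  have h2 := card_nonZeroDivisors_absNorm_le_le K N
  have hNB : (N : ℝ) ≤ B := Nat.floor_le hB0
  have hB2 : B ^ 2 = (4 : ℝ) ^ finrank ℚ K * |(discr K : ℝ)| := by
    rw [hB, mul_pow, Real.sq_sqrt (abs_nonneg _), ← pow_mul, mul_comm (finrank ℚ K) 2, pow_mul]
    norm_num
  calc (classNumber K : ℝ)
      ≤ Nat.card {I : (Ideal (𝓞 K))⁰ // Ideal.absNorm (I : Ideal (𝓞 K)) ≤ N} := by exact_mod_cast h1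
    _ ≤ (N : ℝ) ^ 2 * Real.exp (finrank ℚ K) := h2
    _ ≤ B ^ 2 * Real.exp (finrank ℚ K) := by gcongr
    _ = (4 * Real.exp 1) ^ finrank ℚ K * |(discr K : ℝ)| := by
        rw [hB2, mul_pow, ← Real.exp_one_pow]
        ring

namespace ThornerZaman

/-- `n_K ≤ Q = |d_K| n_K^{n_K}` (`|d_K| ≥ 1`, `n ≤ nⁿ`). [folklore] -/
theorem finrank_le_condQn : (finrank ℚ K : ℝ) ≤ condQn K := by
  have h1 : (1 : ℝ) ≤ |(discr K : ℝ)| := by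
    rw [← Int.cast_abs]
    exact_mod_cast Int.one_le_abs (discr_ne_zero K)
  have hn1 : (1 : ℝ) ≤ finrank ℚ K := by exact_mod_cast Module.finrank_pos (R := ℚ) (M := K)
  have h2 : (finrank ℚ K : ℝ) ≤ (finrank ℚ K : ℝ) ^ finrank ℚ K := by
    calc (finrank ℚ K : ℝ) = (finrank ℚ K : ℝ) ^ 1 := (pow_one _).symm
      _ ≤ (finrank ℚ K : ℝ) ^ finrank ℚ K := pow_le_pow_right₀ hn1 Module.finrank_pos
  unfold condQn
  nlinarith

/-- `Q = |d_K| n_K^{n_K} ≥ 12` when `n_K > 1` (Minkowski: `|d_K| ≥ 3`, Mathlib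
`NumberField.abs_discr_gt_two`; `n_K^{n_K} ≥ 4`). [folklore] -/
theorem twelve_le_condQn (hK : 1 < finrank ℚ K) : 12 ≤ condQn K := by
  have h := NumberField.abs_discr_gt_two hK
  have h3 : (3 : ℝ) ≤ |(discr K : ℝ)| := by
    rw [← Int.cast_abs]
    exact_mod_cast (show (3 : ℤ) ≤ |discr K| by omega)
  have h4 : (4 : ℝ) ≤ (finrank ℚ K : ℝ) ^ finrank ℚ K := by
    have h22 : (2 : ℝ) ^ 2 ≤ (finrank ℚ K : ℝ) ^ finrank ℚ K := by
      calc (2 : ℝ) ^ 2 ≤ (finrank ℚ K : ℝ) ^ 2 := by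
            gcongr; exact_mod_cast hK
        _ ≤ (finrank ℚ K : ℝ) ^ finrank ℚ K :=
            pow_le_pow_right₀ (by exact_mod_cast hK.le) hK
    norm_num at h22
    exact h22
  unfold condQn
  nlinarith

/-- `(4e)^{n} ≤ (nⁿ)⁴` for `n ≥ 2` (`4e < 11 ≤ 16 ≤ n⁴`). [folklore] -/
theorem four_mul_exp_one_pow_le {n : ℕ} (hn : 2 ≤ n) :
    (4 * Real.exp 1) ^ n ≤ ((n : ℝ) ^ n) ^ 4 := by
  have he : Real.exp 1 < 2.7182818286 := Real.exp_one_lt_d9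
  have h16 : 4 * Real.exp 1 ≤ (n : ℝ) ^ 4 := by
    have hn2 : (2 : ℝ) ≤ n := by exact_mod_cast hn
    have : (2 : ℝ) ^ 4 ≤ (n : ℝ) ^ 4 := pow_le_pow_left₀ (by norm_num) hn2 4
    nlinarith
  calc (4 * Real.exp 1) ^ n ≤ ((n : ℝ) ^ 4) ^ n := pow_le_pow_left₀ (by positivity) h16 n
    _ = ((n : ℝ) ^ n) ^ 4 := by rw [← pow_mul, ← pow_mul, mul_comm]

/-- **`h_K ≤ Q⁴`**, `Q = |d_K| n_K^{n_K}`, for every number field of degree `n_K > 1`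
(`h_K ≤ (4e)^{n_K} |d_K|`, `(4e)^{n} ≤ n^{4n}`, `|d_K| ≤ |d_K|⁴`).  The form in which the
class number enters the absorption step of [ThornerZaman2019, §5] (there via Lemma 2.4,
`log D_L ≪ Q²`). [cite: ThornerZaman2019, Lemma 2.4] -/
theorem classNumber_le_condQn_pow (hK : 1 < finrank ℚ K) :
    (classNumber K : ℝ) ≤ condQn K ^ (4 : ℕ) := by
  have h1 : (1 : ℝ) ≤ |(discr K : ℝ)| := by
    rw [← Int.cast_abs]
    exact_mod_cast Int.one_le_abs (discr_ne_zero K)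
  have hd4 : |(discr K : ℝ)| ≤ |(discr K : ℝ)| ^ 4 := by
    calc |(discr K : ℝ)| = |(discr K : ℝ)| ^ 1 := (pow_one _).symm
      _ ≤ |(discr K : ℝ)| ^ 4 := pow_le_pow_right₀ h1 (by norm_num)
  have hpow := four_mul_exp_one_pow_le (n := finrank ℚ K) hK
  have hnn : (0 : ℝ) ≤ ((finrank ℚ K : ℝ) ^ finrank ℚ K) ^ 4 := by positivity
  calc (classNumber K : ℝ) ≤ (4 * Real.exp 1) ^ finrank ℚ K * |(discr K : ℝ)| :=
        classNumber_le_exp_mul_absdiscr K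
    _ ≤ ((finrank ℚ K : ℝ) ^ finrank ℚ K) ^ 4 * |(discr K : ℝ)| ^ 4 :=
        mul_le_mul hpow hd4 (by positivity) hnn
    _ = condQn K ^ (4 : ℕ) := by rw [condQn, mul_pow, mul_comm]

/-! ### The error term -/

/-- `errorTermN c Q n (√x) = errorTermN (c/2) Q n x` (`log √x = (log x)/2`). [folklore] -/
theorem errorTermN_sqrt (c Q : ℝ) (n : ℕ) {x : ℝ} (hx : 0 ≤ x) :
    errorTermN c Q n (Real.sqrt x) = errorTermN (c / 2) Q n x := by
  simp only [errorTermN, Real.log_sqrt hx]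
  ring_nf

/-- The error term is non-increasing in `x ≥ 1` (for `c ≥ 0`, `Q > 1`). [folklore] -/
theorem errorTermN_antitoneOn {c Q : ℝ} (hc : 0 ≤ c) (hQ : 1 < Q) (n : ℕ) :
    AntitoneOn (errorTermN c Q n) (Set.Ici 1) := by
  intro a ha b _ hab
  have ha1 : (1 : ℝ) ≤ a := ha
  have hlog : Real.log a ≤ Real.log b := Real.log_le_log (by linarith) hab
  have hQ' : 0 < Real.log Q := Real.log_pos hQ
  unfold errorTermN
  refine add_le_add (Real.exp_le_exp.mpr ?_) (Real.exp_le_exp.mpr ?_)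
  · have : c * Real.log a / Real.log Q ≤ c * Real.log b / Real.log Q :=
      div_le_div_of_nonneg_right (mul_le_mul_of_nonneg_left hlog hc) hQ'.le
    linarith
  · have : Real.sqrt (c * Real.log a) / Real.sqrt n ≤ Real.sqrt (c * Real.log b) / Real.sqrt n :=
      div_le_div_of_nonneg_right (Real.sqrt_le_sqrt (by nlinarith)) (Real.sqrt_nonneg _)
    linarith

/-- The error term dominates its first summand: `e^{−c log x/log Q} ≤ errorTermN c Q n x`.
[folklore] -/
theorem exp_le_errorTermN (c Q : ℝ) (n : ℕ) (x : ℝ) :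
    Real.exp (-(c * Real.log x / Real.log Q)) ≤ errorTermN c Q n x :=
  le_add_of_nonneg_right (Real.exp_nonneg _)

/-- Monotonicity of the error term in `c`: for `c' ≤ c` (and `x ≥ 1`, `Q > 1`),
`errorTermN c Q n x ≤ errorTermN c' Q n x`. [folklore] -/
theorem errorTermN_le_of_le {c c' Q : ℝ} (hcc : c' ≤ c) (hQ : 1 < Q) (n : ℕ) {x : ℝ}
    (hx : 1 ≤ x) : errorTermN c Q n x ≤ errorTermN c' Q n x := by
  have hlt : 0 ≤ Real.log x := Real.log_nonneg hx
  have hlQ : 0 < Real.log Q := Real.log_pos hQ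
  unfold errorTermN
  refine add_le_add (Real.exp_le_exp.mpr ?_) (Real.exp_le_exp.mpr ?_)
  · have : c' * Real.log x / Real.log Q ≤ c * Real.log x / Real.log Q :=
      div_le_div_of_nonneg_right (mul_le_mul_of_nonneg_right hcc hlt) hlQ.le
    linarith
  · have : Real.sqrt (c' * Real.log x) / Real.sqrt n ≤ Real.sqrt (c * Real.log x) / Real.sqrt n :=
      div_le_div_of_nonneg_right (Real.sqrt_le_sqrt (by nlinarith)) (Real.sqrt_nonneg _)
    linarith

end ThornerZaman

end Literature.NumberTheory.LFunctions.NumberField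

end
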